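import Summits.BirchSwinnertonDyer.BirchSwinnertonDyer.Theorems.InertBadSignedBranchesCccOneLawOnTypeIstarZeroManinTwistOnType
import Summits.BirchSwinnertonDyer.BirchSwinnertonDyer.Theorems.InertBadSignedBranchesCccOneLawOnTypeIstarZeroOfBSDpKForm
import HarnessLib

/-!
# Route `InertBadSignedBranches` (rung K8), crux `CccOneLawOnTypeIstarZero` (stmt-…-19223):
# THE CRUX IS EXACTLY STEP L ON THE TYPE, AT EVERY `p ≥ 5` — `CccOneLawOnTypeIstarZero ⟺
# ∀ p ≥ 5, X12.O10.LowerHalfOnType p I₀*` modulo the route's OWN items (19501, 19502, 19227) and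
# published facts (helper toward stmt-BirchSwinnertonDyer-19223; cell bsd-cm, seat bsd-cm-k8i-c2 g6;
# corollary of `…ManinTwistOnType` + k8i-c2 g4's `…OfBSDpKForm`; nothing booked)

WHAT. k8i-c2 g4 (`CccOneKFormConverse.cccOneLawOnTypeIstarZero_iff_bsdpOnType_of_plusMCEtaK`) proved, over
the rev-4 items `PlusMCEtaK` (19501), `SignedReadingFacts` (19502), `PublishedFactsInert` (19227):
crux ⟺ `BSD(W, p)` for every rank-one `W` of signed type `(p, I₀*)`, `p ≥ 5`; and crux ⟹
`LowerHalfOnType p I₀*`. The converse «lower half ⟹ crux» needed the Kolyvagin UPPER half on the type,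
published at `p ≥ 11` only (Edixhoven). With `CccOneManinTwist.missingUpperBoundAt_of_hasSignedLocalType_IstarZero`
(the upper half at EVERY `p ≥ 5` from published facts, Mazur 1978 Cor. 4.1 at the good prime of the
twin) the equivalence closes at every `p ≥ 5`:
* `bsdpOnType_of_lowerHalfOnType_of_facts` — `(∀ p ≥ 5, LowerHalfOnType p I₀*) ⟹ BSD(W, p)` on the
  type at every `p ≥ 5`, from the nine published facts (lower ∧ upper ⟹ `MissingPPartAt` ⟹ `BSDp`,
  GZK);
* **`cccOneLawOnTypeIstarZero_iff_lowerHalfOnType_of_plusMCEtaK`** — `CccOneLawOnTypeIstarZero ⟺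
  ∀ p ≥ 5, LowerHalfOnType p I₀*`, modulo `hK hR h₆` (route items, VERBATIM) and `hGZ hKo hMN hFH hCM8`
  (published named facts);
* `cmInertBad_of_lowerHalfOnType_of_routeItems` — the route's deciding shape with the crux `h₁` REPLACED
  by STEP L: `(∀ p ≥ 5, LowerHalfOnType p I₀*) → InertBadOffType → InertBadAtThree → PlusMCEtaK →
  SignedReadingFacts → PublishedFactsInert → LeafBridgeEtaK → (facts) → X12.CMInertBad` (through
  `closes` with `h₁` supplied by the iff).
READING (no label change; nothing booked): 19223 and «STEP L on the type `(p, I₀*)`, every `p ≥ 5`» are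
the SAME item modulo the route's own support items and print — at every prime, not only `p ≥ 11`.

HONEST LABEL: theorems only (no `def`, no named fact, no `sorry`); every statement is CONDITIONAL on the
displayed route items (conjecture-grade `PlusMCEtaK` included) and published facts; the crux, STEP L, O10
and the leaf stay OPEN; BSD is not proved for any curve here.

References: B. Mazur, Invent. Math. 44 (1978) Cor. 4.1; G. Stevens, Invent. Math. 98 (1989) §5;
S. Kobayashi, Invent. Math. 152 (2003) §4, Thm. 7.4, Thm. 9.3; R. Pollack, K. Rubin, Ann. Math. 159
(2004); R. L. Miller, LMS J. Comput. Math. 14 (2011) §1.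
-/

set_option autoImplicit false
set_option linter.dupNamespace false

noncomputable section

open scoped Classical MatrixGroups ModularForm NumberField

open CongruenceSubgroup Field WeierstrassCurve NumberField IsDedekindDomain
open Literature.NumberTheory.EllipticCurves
open Literature.NumberTheory.EllipticCurves.ModularForms
open Literature.NumberTheory.EllipticCurves.Rank1Residual
open Literature.NumberTheory.EllipticCurves.Rank1Residual.Typed
open Summit.BirchSwinnertonDyer.Rank1Residual
open Summit.BirchSwinnertonDyer.Rank1Residual.X12.O10
open Summit.BirchSwinnertonDyer.BirchSwinnertonDyer.Theses.InertBadSignedBranches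

namespace Summit.BirchSwinnertonDyer.BirchSwinnertonDyer.Theorems.CccOneManinTwist

/-- **STEP L on the type gives `BSD(W, p)` on the type, at every `p ≥ 5`, from published facts**:
`(∀ p ≥ 5, LowerHalfOnType p I₀*) →` for every globally minimal `W` of signed type `(p, I₀*)` with
`r_an = 1`, `BSDp W p` — lower half (hypothesis) ∧ upper half
(`missingUpperBoundAt_of_hasSignedLocalType_IstarZero`) ⟹ `MissingPPartAt` ⟹ `BSDp` (GZK).
CONDITIONAL; nothing booked. [cite: Mazur1978, Cor. 4.1] [cite: Miller2011LMS, §1 and Def. 1.1] -/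
theorem bsdpOnType_of_lowerHalfOnType_of_facts
    (hGZ : ∀ (N : ℕ) [NeZero N] (W : WeierstrassCurve ℚ) (K : Type) [Field K] [NumberField K],
      gross_zagier N W K)
    (hKo : ∀ (N : ℕ) [NeZero N] (W : WeierstrassCurve ℚ) (K : Type) [Field K] [NumberField K],
      kolyvagin N W K)
    (hMN : ∀ (N : ℕ) [NeZero N] (W : WeierstrassCurve ℚ) (K : Type) [Field K] [NumberField K],
      MatarNekovar2019.thm03_padicValNat_card_sha_le_of_irreducible N W K)
    (hGZK : rank_eq_analyticRank_of_analyticRank_le_one) (hmod : hasEntireLFunction_rat)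
    (hnf : exists_isNewformOf) (hFH : friedbergHoffstein_exists_heegnerField_split_twist_ne_zero)
    (hCM8 : bsdTriple_of_hasCM_of_L_one_ne_zero) (hMaz : mazur_not_dvd_maninConstant_of_odd)
    (hlow : ∀ (p : ℕ) [Fact p.Prime], 5 ≤ p → LowerHalfOnType p (.Istar 0)) :
    ∀ (p : ℕ) [Fact p.Prime], 5 ≤ p → ∀ (W : WeierstrassCurve ℚ) [W.IsElliptic]
      [W.IsGloballyMinimal], HasSignedLocalType W p (.Istar 0) → W.analyticRank = 1 → BSDp W p := by
  intro p _ hp5 W _ _ hT hr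
  exact bsdp_of_missingPPartAt W p hGZK (by rw [hr])
    (missingPPartAt_of_lower_of_upper W p (hlow p hp5 W hT hr)
      (missingUpperBoundAt_of_hasSignedLocalType_IstarZero p hGZ hKo hMN hGZK hmod hnf hFH hCM8 hMaz W
        hp5 hT hr))

/-- **THE CRUX IS EXACTLY STEP L ON THE TYPE, AT EVERY `p ≥ 5`.** Modulo the route's items
`PlusMCEtaK` (stmt-…-19501, VERBATIM), `SignedReadingFacts` (19502), `PublishedFactsInert` (19227) and
the published facts `hGZ hKo hMN hFH hCM8`:
`CccOneLawOnTypeIstarZero ⟺ ∀ p ≥ 5, X12.O10.LowerHalfOnType p I₀*`. (→) k8i-c2 g4's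
`CccOneKFormConverse.lowerHalfOnType_of_cccOneLawOnTypeIstarZero_of_plusMCEtaK`; (←)
`bsdpOnType_of_lowerHalfOnType_of_facts` + g4's `cccOneLawOnTypeIstarZero_iff_bsdpOnType_of_plusMCEtaK`.
Before this file the (←) direction was available at `p ≥ 11` only (the Manin datum). CONDITIONAL;
nothing booked; both sides stay OPEN. [cite: Mazur1978, Cor. 4.1] [cite: Kobayashi2003, §4 (p. 8) and Thm. 7.4 (p. 13)]
[cite: Miller2011LMS, §1 and Def. 1.1] -/
theorem cccOneLawOnTypeIstarZero_iff_lowerHalfOnType_of_plusMCEtaK (hK : PlusMCEtaK)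
    (hR : SignedReadingFacts) (h₆ : PublishedFactsInert)
    (hGZ : ∀ (N : ℕ) [NeZero N] (W : WeierstrassCurve ℚ) (K : Type) [Field K] [NumberField K],
      gross_zagier N W K)
    (hKo : ∀ (N : ℕ) [NeZero N] (W : WeierstrassCurve ℚ) (K : Type) [Field K] [NumberField K],
      kolyvagin N W K)
    (hMN : ∀ (N : ℕ) [NeZero N] (W : WeierstrassCurve ℚ) (K : Type) [Field K] [NumberField K],
      MatarNekovar2019.thm03_padicValNat_card_sha_le_of_irreducible N W K)
    (hFH : friedbergHoffstein_exists_heegnerField_split_twist_ne_zero)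
    (hCM8 : bsdTriple_of_hasCM_of_L_one_ne_zero) :
    CccOneLawOnTypeIstarZero ↔ ∀ (p : ℕ) [Fact p.Prime], 5 ≤ p → LowerHalfOnType p (.Istar 0) := by
  obtain ⟨hmod, -, hGZK, -, hnf, hMaz⟩ := id h₆
  refine ⟨fun h₁ p _ hp5 ↦
    CccOneKFormConverse.lowerHalfOnType_of_cccOneLawOnTypeIstarZero_of_plusMCEtaK hK hR h₆ h₁ p hp5,
    fun hlow ↦ ?_⟩
  exact (CccOneKFormConverse.cccOneLawOnTypeIstarZero_iff_bsdpOnType_of_plusMCEtaK hK hR h₆).mpr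
    (bsdpOnType_of_lowerHalfOnType_of_facts hGZ hKo hMN hGZK hmod hnf hFH hCM8 hMaz hlow)

/-- **The route's deciding shape with the crux REPLACED by STEP L** (what a route re-lined on the lower
half would close with, every other binder VERBATIM the route's): `(∀ p ≥ 5, LowerHalfOnType p I₀*) →
InertBadOffType → InertBadAtThree → PlusMCEtaK → SignedReadingFacts → PublishedFactsInert →
LeafBridgeEtaK → (hGZ hKo hMN hFH hCM8) → X12.CMInertBad` — `closes` with `h₁` from the iff.
CONDITIONAL; nothing booked; the leaf stays OPEN. [cite: Mazur1978, Cor. 4.1]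
[cite: Kobayashi2003, §4 (p. 8) and Thm. 7.4 (p. 13)] -/
theorem cmInertBad_of_lowerHalfOnType_of_routeItems
    (hlow : ∀ (p : ℕ) [Fact p.Prime], 5 ≤ p → LowerHalfOnType p (.Istar 0))
    (h₂ : InertBadOffType) (h₃ : InertBadAtThree) (hK : PlusMCEtaK) (hR : SignedReadingFacts)
    (h₆ : PublishedFactsInert) (hB : LeafBridgeEtaK)
    (hGZ : ∀ (N : ℕ) [NeZero N] (W : WeierstrassCurve ℚ) (K : Type) [Field K] [NumberField K],
      gross_zagier N W K)
    (hKo : ∀ (N : ℕ) [NeZero N] (W : WeierstrassCurve ℚ) (K : Type) [Field K] [NumberField K],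
      kolyvagin N W K)
    (hMN : ∀ (N : ℕ) [NeZero N] (W : WeierstrassCurve ℚ) (K : Type) [Field K] [NumberField K],
      MatarNekovar2019.thm03_padicValNat_card_sha_le_of_irreducible N W K)
    (hFH : friedbergHoffstein_exists_heegnerField_split_twist_ne_zero)
    (hCM8 : bsdTriple_of_hasCM_of_L_one_ne_zero) :
    Summit.BirchSwinnertonDyer.Rank1Residual.X12.CMInertBad :=
  closes ((cccOneLawOnTypeIstarZero_iff_lowerHalfOnType_of_plusMCEtaK hK hR h₆ hGZ hKo hMN hFH hCM8).mpr
    hlow) h₂ h₃ hK hR h₆ hB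

end Summit.BirchSwinnertonDyer.BirchSwinnertonDyer.Theorems.CccOneManinTwist

end
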